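import Mathlib
import Literature.NumberTheory.Transcendental.KZCalculusProofs
import Literature.NumberTheory.Transcendental.SemialgebraicMapsProofs
import Literature.NumberTheory.Transcendental.KZSemialgebraicComplex
import Literature.NumberTheory.Transcendental.KZLogCalculusProofs
import HarnessLib

/-!
# `OffTetraSectorKernel`, line `deform-to-the-oracle`: the Cayley–shear move

Stub `stub_cayleyShear` of the crux `OffTetraSectorKernel` (stmt-KontsevichZagierPeriods-10557,
route HyperbolicBloch), move 1 of the Catalan calibration: ONE instance of Kontsevich–Zagier's
rule (2) (`KZ.changeOfVariablesRel`). Coordinates `x 0 = x`, `x 1 = y` on the half-closed square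
`K = {0 < x ≤ 1, 0 < y < 1}` and `w 0 = s`, `w 1 = y'` on the band
`B = {0 < s < 1, 1 − s < y' ≤ 1 + s}`. The Cayley–shear map
`Φ(x, y) = ((1 − xy)/(1 + xy), 2x/(1 + xy))` (composite of `(x, y) ↦ (xy, x)` and the Cayley map
`p ↦ (1 − p)/(1 + p)`, `y' = 2x/(1 + p)`) maps `K` bijectively onto `B` (inverse
`x = y'/(1 + s)`, `y = (1 − s)/y'`), with `|det DΦ| = 4x/(1 + xy)³`, and the Jacobian identity
`1/(1 + x²y²) = g(Φ(x, y)) · 4x/(1 + xy)³`, `g(s, y') = 1/((1 + s²) y')`, holds because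
`1 + s² = 2(1 + x²y²)/(1 + xy)²`. Hence `[K, 1/(1 + x²y²)] − [B, g] ∈ changeOfVariablesRel`, and
a representation `[B, g]` EXISTS: `Φ(K)` is `ℚ`-semialgebraic by Tarski–Seidenberg
(`IsSemialgebraicMapOn.isSemialgebraic_image_holds`), `g` is a quotient of `ℚ`-polynomials with
denominator `(1 + s²) y' > 0` on `B`, and `g` is integrable on `Φ(K)` by Mathlib's
change-of-variables criterion
`MeasureTheory.integrableOn_image_iff_integrableOn_abs_det_fderiv_smul` (the pulled-back
integrand `|det DΦ| · g ∘ Φ` IS `1/(1 + x²y²) = K.integrand` on `K`).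

References: M. Kontsevich, D. Zagier, *Periods* (2001), §1.2 rule (2); J. Bochnak, M. Coste,
M.-F. Roy, *Real Algebraic Geometry* (1998), §2.2 (Prop. 2.2.6, 2.2.7).
-/

noncomputable section

open Set MeasureTheory MvPolynomial
open Literature.NumberTheory.Transcendental Literature.ModelTheory.ExponentialFields

namespace Summit.KontsevichZagierPeriods.HyperbolicBloch.OffTetraSectorKernel

/-! ## Algebra of the Cayley–shear map -/

/-- The coordinates of the Cayley–shear map `Φ(x, y) = ((1 − xy)/(1 + xy), 2x/(1 + xy))`.
[folklore] -/
theorem cayleyShear_apply (Φ : (Fin 2 → ℝ) → (Fin 2 → ℝ))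
    (hΦ : ∀ x, Φ x = ![(1 - x 0 * x 1) / (1 + x 0 * x 1), 2 * x 0 / (1 + x 0 * x 1)])
    (x : Fin 2 → ℝ) :
    Φ x 0 = (1 - x 0 * x 1) / (1 + x 0 * x 1) ∧ Φ x 1 = 2 * x 0 / (1 + x 0 * x 1) := by
  rw [hΦ]
  exact ⟨rfl, rfl⟩

/-- `1 + s = 2/(1 + xy)` and `1 − s = 2xy/(1 + xy)` for `s = (1 − xy)/(1 + xy)`
(`1 + xy ≠ 0`). [folklore] -/
theorem cayleyShear_one_add_sub {p : ℝ} (hp : 1 + p ≠ 0) :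
    1 + (1 - p) / (1 + p) = 2 / (1 + p) ∧ 1 - (1 - p) / (1 + p) = 2 * p / (1 + p) := by
  constructor
  · field_simp
    ring
  · field_simp
    ring

/-- **Left inverse of the Cayley–shear map**: `x = y'/(1 + s)` and `y = (1 − s)/y'` for
`(s, y') = Φ(x, y)` (`x ≠ 0`, `1 + xy ≠ 0`). [folklore] -/
theorem cayleyShear_leftInv (Φ : (Fin 2 → ℝ) → (Fin 2 → ℝ))
    (hΦ : ∀ x, Φ x = ![(1 - x 0 * x 1) / (1 + x 0 * x 1), 2 * x 0 / (1 + x 0 * x 1)])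
    {x : Fin 2 → ℝ} (h0 : x 0 ≠ 0) (hd : 1 + x 0 * x 1 ≠ 0) :
    Φ x 1 / (1 + Φ x 0) = x 0 ∧ (1 - Φ x 0) / Φ x 1 = x 1 := by
  obtain ⟨e0, e1⟩ := cayleyShear_apply Φ hΦ x
  obtain ⟨ha, hs⟩ := cayleyShear_one_add_sub hd
  rw [e0, e1, ha, hs]
  constructor
  · field_simp
  · field_simp

/-- The Cayley–shear map is injective on `{x ≠ 0, 1 + xy ≠ 0}`, in particular on the square.
[folklore] -/
theorem cayleyShear_injOn (Φ : (Fin 2 → ℝ) → (Fin 2 → ℝ))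
    (hΦ : ∀ x, Φ x = ![(1 - x 0 * x 1) / (1 + x 0 * x 1), 2 * x 0 / (1 + x 0 * x 1)]) :
    InjOn Φ {x | 0 < x 0 ∧ x 0 ≤ 1 ∧ 0 < x 1 ∧ x 1 < 1} := by
  rintro x ⟨h0, -, h1, -⟩ x' ⟨h0', -, h1', -⟩ h
  obtain ⟨f0, f1⟩ := cayleyShear_leftInv Φ hΦ h0.ne' (by nlinarith [mul_pos h0 h1])
  obtain ⟨g0, g1⟩ := cayleyShear_leftInv Φ hΦ h0'.ne' (by nlinarith [mul_pos h0' h1'])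
  rw [h] at f0 f1
  funext i
  fin_cases i
  · exact f0.symm.trans g0
  · exact f1.symm.trans g1

/-- **The image of the half-closed square under the Cayley–shear map is the band**
`{0 < s < 1, 1 − s < y' ≤ 1 + s}`: with `p = xy ∈ (0, 1)`, `s = (1 − p)/(1 + p) ∈ (0, 1)`,
`1 − s = 2p/(1 + p) < 2x/(1 + p) = y'` iff `y < 1`, and `y' ≤ 2/(1 + p) = 1 + s` iff `x ≤ 1`; the
inverse is `x = y'/(1 + s)`, `y = (1 − s)/y'`. [folklore] -/
theorem cayleyShear_image (Φ : (Fin 2 → ℝ) → (Fin 2 → ℝ))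
    (hΦ : ∀ x, Φ x = ![(1 - x 0 * x 1) / (1 + x 0 * x 1), 2 * x 0 / (1 + x 0 * x 1)]) :
    Φ '' {x | 0 < x 0 ∧ x 0 ≤ 1 ∧ 0 < x 1 ∧ x 1 < 1} =
      {w | 0 < w 0 ∧ w 0 < 1 ∧ 1 - w 0 < w 1 ∧ w 1 ≤ 1 + w 0} := by
  ext w
  constructor
  · -- `Φ` maps the square into the band
    rintro ⟨x, ⟨h0, h1, hl0, hl1⟩, rfl⟩
    obtain ⟨e0, e1⟩ := cayleyShear_apply Φ hΦ x
    have hp : 0 < x 0 * x 1 := mul_pos h0 hl0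
    have hpx : x 0 * x 1 < x 0 := by nlinarith
    have hd : 0 < 1 + x 0 * x 1 := by linarith
    obtain ⟨ha, hs⟩ := cayleyShear_one_add_sub hd.ne'
    simp only [mem_setOf_eq, e0, e1]
    refine ⟨div_pos (by linarith) hd, (div_lt_one hd).2 (by linarith), ?_, ?_⟩
    · rw [hs]
      exact div_lt_div_of_pos_right (by linarith) hd
    · rw [ha]
      exact div_le_div_of_nonneg_right (by linarith) hd.le
  · -- the band is covered: `x = y'/(1 + s)`, `y = (1 − s)/y'`
    rintro ⟨h0, h1, hy, hy'⟩
    have hs1 : 0 < 1 + w 0 := by linarith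
    have hyp : 0 < w 1 := by linarith
    refine ⟨![w 1 / (1 + w 0), (1 - w 0) / w 1], ?_, ?_⟩
    · simp only [mem_setOf_eq, Matrix.cons_val_zero, Matrix.cons_val_one, Matrix.cons_val_fin_one]
      exact ⟨div_pos hyp hs1, (div_le_one hs1).2 hy', div_pos (by linarith) hyp,
        (div_lt_one hyp).2 hy⟩
    · have hp : w 1 / (1 + w 0) * ((1 - w 0) / w 1) = (1 - w 0) / (1 + w 0) := by
        field_simp
      have hq : 1 + (1 - w 0) / (1 + w 0) = 2 / (1 + w 0) := by
        field_simp
        ring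
      have hr : 1 - (1 - w 0) / (1 + w 0) = 2 * w 0 / (1 + w 0) := by
        field_simp
        ring
      rw [hΦ]
      funext i
      fin_cases i
      · simp only [Fin.zero_eta, Fin.isValue, Matrix.cons_val_zero, Matrix.cons_val_one,
          Matrix.cons_val_fin_one]
        rw [hp, hq, hr]
        field_simp
      · simp only [Fin.mk_one, Fin.isValue, Matrix.cons_val_one, Matrix.cons_val_zero,
          Matrix.cons_val_fin_one]
        rw [hp, hq]
        field_simp

/-! ## Semialgebraicity -/

/-- The Cayley–shear map is a `ℚ`-semialgebraic map on every `ℚ`-semialgebraic `σ` on which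
`1 + xy ≠ 0`: its coordinates are quotients of `ℚ`-polynomials with non-vanishing denominator.
[cite: KontsevichZagier2001, §1.1] -/
theorem cayleyShear_isSemialgebraicMapOn (Φ : (Fin 2 → ℝ) → (Fin 2 → ℝ))
    (hΦ : ∀ x, Φ x = ![(1 - x 0 * x 1) / (1 + x 0 * x 1), 2 * x 0 / (1 + x 0 * x 1)])
    {σ : Set (Fin 2 → ℝ)} (hσ : IsSemialgebraic ℚ σ) (hd : ∀ x ∈ σ, 1 + x 0 * x 1 ≠ 0) :
    IsSemialgebraicMapOn ℚ σ Φ := by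
  have hev : ∀ x : Fin 2 → ℝ, aeval x (1 + X 0 * X 1 : MvPolynomial (Fin 2) ℚ) = 1 + x 0 * x 1 :=
    fun x => by simp
  have hq : ∀ x ∈ σ, aeval x (1 + X 0 * X 1 : MvPolynomial (Fin 2) ℚ) ≠ 0 := fun x hx => by
    rw [hev]
    exact hd x hx
  refine IsSemialgebraicMapOn.of_forall hσ fun j => ?_
  fin_cases j
  · refine (isSemialgebraicFunOn_aeval_div_aeval hσ (1 - X 0 * X 1) (1 + X 0 * X 1) hq).congr
      fun x _ => ?_
    simp [(cayleyShear_apply Φ hΦ x).1]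
  · refine (isSemialgebraicFunOn_aeval_div_aeval hσ (C 2 * X 0) (1 + X 0 * X 1) hq).congr
      fun x _ => ?_
    simp [(cayleyShear_apply Φ hΦ x).2]

/-! ## The derivative -/

/-- **The derivative of the Cayley–shear map and its determinant.** At a point with `1 + xy ≠ 0`,
`Φ` has the Fréchet derivative of matrix `(1 + xy)⁻² · [[−2y, −2x], [2, −2x²]]`, of determinant
`4x(1 + xy)/(1 + xy)⁴ = 4x/(1 + xy)³`. [folklore] -/
theorem cayleyShear_hasFDerivAt_det (Φ : (Fin 2 → ℝ) → (Fin 2 → ℝ))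
    (hΦ : ∀ x, Φ x = ![(1 - x 0 * x 1) / (1 + x 0 * x 1), 2 * x 0 / (1 + x 0 * x 1)])
    {x : Fin 2 → ℝ} (hx : 1 + x 0 * x 1 ≠ 0) :
    ∃ L : (Fin 2 → ℝ) →L[ℝ] (Fin 2 → ℝ), HasFDerivAt Φ L x ∧
      L.det = 4 * x 0 / (1 + x 0 * x 1) ^ 3 := by
  set M : Matrix (Fin 2) (Fin 2) ℝ := !![-(2 * x 1) / (1 + x 0 * x 1) ^ 2,
    -(2 * x 0) / (1 + x 0 * x 1) ^ 2; 2 / (1 + x 0 * x 1) ^ 2,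
    -(2 * x 0 ^ 2) / (1 + x 0 * x 1) ^ 2] with hM
  refine ⟨LinearMap.toContinuousLinearMap (Matrix.toLin' M), ?_, ?_⟩
  · -- derivative, componentwise
    have e0 : HasFDerivAt (fun y : Fin 2 → ℝ => y 0) (ContinuousLinearMap.proj 0) x :=
      hasFDerivAt_apply (𝕜 := ℝ) 0 x
    have e1 : HasFDerivAt (fun y : Fin 2 → ℝ => y 1) (ContinuousLinearMap.proj 1) x :=
      hasFDerivAt_apply (𝕜 := ℝ) 1 x
    have hden := (e0.fun_mul e1).const_add 1
    have hinv := (hasDerivAt_inv hx).comp_hasFDerivAt x hden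
    have h0 : HasFDerivAt (fun y => Φ y 0)
        ((ContinuousLinearMap.proj 0).comp (LinearMap.toContinuousLinearMap (Matrix.toLin' M)))
        x := by
      have hf : (fun y => Φ y 0) = fun y : Fin 2 → ℝ =>
          (1 - y 0 * y 1) * ((fun t : ℝ => t⁻¹) ∘ fun y : Fin 2 → ℝ => 1 + y 0 * y 1) y := by
        funext y
        rw [(cayleyShear_apply Φ hΦ y).1, div_eq_mul_inv]
        rfl
      rw [hf]
      refine (((e0.fun_mul e1).const_sub 1).fun_mul hinv).congr_fderiv
        (ContinuousLinearMap.ext fun u => ?_)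
      simp [hM, Matrix.toLin'_apply, dotProduct, Fin.sum_univ_two]
      field_simp
      ring
    have h1 : HasFDerivAt (fun y => Φ y 1)
        ((ContinuousLinearMap.proj 1).comp (LinearMap.toContinuousLinearMap (Matrix.toLin' M)))
        x := by
      have hf : (fun y => Φ y 1) = fun y : Fin 2 → ℝ =>
          2 * y 0 * ((fun t : ℝ => t⁻¹) ∘ fun y : Fin 2 → ℝ => 1 + y 0 * y 1) y := by
        funext y
        rw [(cayleyShear_apply Φ hΦ y).2, div_eq_mul_inv]
        rfl
      rw [hf]
      refine ((e0.const_mul 2).fun_mul hinv).congr_fderiv (ContinuousLinearMap.ext fun u => ?_)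
      simp [hM, Matrix.toLin'_apply, dotProduct, Fin.sum_univ_two]
      field_simp
      ring
    refine hasFDerivAt_pi'' fun i => ?_
    fin_cases i
    exacts [h0, h1]
  · -- determinant
    rw [LinearMap.det_toContinuousLinearMap, LinearMap.det_toLin', Matrix.det_fin_two_of,
      div_mul_div_comm, div_mul_div_comm, ← sub_div,
      div_eq_div_iff (mul_ne_zero (pow_ne_zero 2 hx) (pow_ne_zero 2 hx)) (pow_ne_zero 3 hx)]
    ring

/-- **The Jacobian identity** `1/(1 + x²y²) = g(Φ(x, y)) · |det DΦ(x, y)|` with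
`g(s, y') = 1/((1 + s²) y')`, for `x > 0`, `1 + xy > 0`: indeed `1 + s² = 2(1 + x²y²)/(1 + xy)²`
and `|det DΦ| = 4x/(1 + xy)³`. [cite: KontsevichZagier2001, §1.2 rule (2)] -/
theorem cayleyShear_jacobian {a b : ℝ} (ha : 0 < a) (hd : 0 < 1 + a * b) :
    1 / (1 + a ^ 2 * b ^ 2) = 1 / ((1 + ((1 - a * b) / (1 + a * b)) ^ 2) * (2 * a / (1 + a * b))) *
      |4 * a / (1 + a * b) ^ 3| := by
  rw [abs_of_pos (div_pos (by linarith) (pow_pos hd 3))]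
  have key : 1 + ((1 - a * b) / (1 + a * b)) ^ 2 = 2 * (1 + a ^ 2 * b ^ 2) / (1 + a * b) ^ 2 := by
    field_simp
    ring
  have hq : (0 : ℝ) < 1 + a ^ 2 * b ^ 2 := by positivity
  rw [key]
  field_simp
  ring

/-- **Cayley–shear move data**: a map `Φ'` which is a derivative of `Φ` wherever `1 + xy ≠ 0`,
with `det Φ'(x, y) = 4x/(1 + xy)³` there. [folklore] -/
theorem cayleyShear_moveData (Φ : (Fin 2 → ℝ) → (Fin 2 → ℝ))
    (hΦ : ∀ x, Φ x = ![(1 - x 0 * x 1) / (1 + x 0 * x 1), 2 * x 0 / (1 + x 0 * x 1)]) :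
    ∃ Φ' : (Fin 2 → ℝ) → ((Fin 2 → ℝ) →L[ℝ] (Fin 2 → ℝ)), ∀ x, 1 + x 0 * x 1 ≠ 0 →
      HasFDerivAt Φ (Φ' x) x ∧ (Φ' x).det = 4 * x 0 / (1 + x 0 * x 1) ^ 3 := by
  have hex : ∀ x : Fin 2 → ℝ, ∃ L : (Fin 2 → ℝ) →L[ℝ] (Fin 2 → ℝ), 1 + x 0 * x 1 ≠ 0 →
      HasFDerivAt Φ L x ∧ L.det = 4 * x 0 / (1 + x 0 * x 1) ^ 3 := by
    intro x
    by_cases hx : 1 + x 0 * x 1 ≠ 0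
    · obtain ⟨L, hL, hdet⟩ := cayleyShear_hasFDerivAt_det Φ hΦ hx
      exact ⟨L, fun _ => ⟨hL, hdet⟩⟩
    · exact ⟨0, fun h => (hx h).elim⟩
  choose Φ' hΦ' using hex
  exact ⟨Φ', hΦ'⟩

/-! ## The stub -/

/-- **STUB `stub_cayleyShear`** (rule 2, one `changeOfVariablesRel` instance + existence of the
image representation): the Cayley–shear map `Φ(x) = ((1 − x₀x₁)/(1 + x₀x₁), 2x₀/(1 + x₀x₁))` is
`ℚ`-semialgebraic, injective and smooth on the half-closed square `{0 < x₀ ≤ 1, 0 < x₁ < 1}`, maps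
it ONTO the band `{0 < s < 1, 1 − s < y ≤ 1 + s}`, has `|det DΦ| = 4x₀/(1 + x₀x₁)³`, and
`1/(1 + x₀²x₁²) = g(Φ x)·|det DΦ(x)|` with `g(s,y) = 1/((1 + s²) y)`; so a band representation
`[band, g]` EXISTS (semialgebraic image by Tarski–Seidenberg, quotient integrand with denominator
`(1 + s²) y > 0`, integrable by the change-of-variables criterion) and EVERY such representation is
one change-of-variables move away from `K`. [cite: KontsevichZagier2001, §1.2 rule (2)] -/
theorem stub_cayleyShear : ∀ K : Literature.NumberTheory.Transcendental.KZ.IntegralRep 2, K.domain = {x | 0 < x 0 ∧ x 0 ≤ 1 ∧ 0 < x 1 ∧ x 1 < 1} → Set.EqOn K.integrand (fun x => 1 / (1 + x 0 ^ 2 * x 1 ^ 2)) K.domain → (∃ B : Literature.NumberTheory.Transcendental.KZ.IntegralRep 2, B.domain = {x | 0 < x 0 ∧ x 0 < 1 ∧ 1 - x 0 < x 1 ∧ x 1 ≤ 1 + x 0} ∧ Set.EqOn B.integrand (fun x => 1 / ((1 + x 0 ^ 2) * x 1)) B.domain) ∧ (∀ B : Literature.NumberTheory.Transcendental.KZ.IntegralRep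 2, B.domain = {x | 0 < x 0 ∧ x 0 < 1 ∧ 1 - x 0 < x 1 ∧ x 1 ≤ 1 + x 0} → Set.EqOn B.integrand (fun x => 1 / ((1 + x 0 ^ 2) * x 1)) B.domain → Literature.NumberTheory.Transcendental.KZ.Equivalent K B) := by
  intro K hK hKi
  -- the move `Φ(x, y) = ((1 − xy)/(1 + xy), 2x/(1 + xy))`
  obtain ⟨Φ, hΦ⟩ : ∃ Φ : (Fin 2 → ℝ) → (Fin 2 → ℝ),
      ∀ x, Φ x = ![(1 - x 0 * x 1) / (1 + x 0 * x 1), 2 * x 0 / (1 + x 0 * x 1)] :=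
    ⟨_, fun _ => rfl⟩
  -- `1 + xy > 0` and `x > 0` on the square
  have hdpos : ∀ x ∈ K.domain, 0 < x 0 ∧ 0 < 1 + x 0 * x 1 := by
    rw [hK]
    rintro x ⟨h0, -, h1, -⟩
    exact ⟨h0, by nlinarith [mul_pos h0 h1]⟩
  -- the image is the band
  have himage : Φ '' K.domain = {w | 0 < w 0 ∧ w 0 < 1 ∧ 1 - w 0 < w 1 ∧ w 1 ≤ 1 + w 0} := by
    rw [hK]
    exact cayleyShear_image Φ hΦ
  -- the four data of the move
  have hΦsa : IsSemialgebraicMapOn ℚ K.domain Φ :=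
    cayleyShear_isSemialgebraicMapOn Φ hΦ K.isSemialgebraic_domain fun x hx => (hdpos x hx).2.ne'
  have hinj : InjOn Φ K.domain := by
    rw [hK]
    exact cayleyShear_injOn Φ hΦ
  obtain ⟨Φ', hΦ'⟩ := cayleyShear_moveData Φ hΦ
  have hderiv : ∀ x ∈ K.domain, HasFDerivWithinAt Φ (Φ' x) K.domain x := fun x hx =>
    (hΦ' x (hdpos x hx).2.ne').1.hasFDerivWithinAt
  have hjac : ∀ x ∈ K.domain, K.integrand x =
      1 / ((1 + Φ x 0 ^ 2) * Φ x 1) * |(Φ' x).det| := by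
    intro x hx
    obtain ⟨h0, hd⟩ := hdpos x hx
    obtain ⟨e0, e1⟩ := cayleyShear_apply Φ hΦ x
    rw [hKi hx, (hΦ' x hd.ne').2, e0, e1]
    exact cayleyShear_jacobian h0 hd
  have hmeas : MeasurableSet K.domain := KZ.IntegralRep.measurableSet_domain_holds K
  -- EXISTENCE of `[band, g]`: semialgebraic image, quotient integrand, change of variables
  have hT : IsSemialgebraic ℚ (Φ '' K.domain) :=
    IsSemialgebraicMapOn.isSemialgebraic_image_holds hΦsa subset_rfl K.isSemialgebraic_domain
  have hpos : ∀ w ∈ Φ '' K.domain, 0 < w 1 := by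
    rw [himage]
    rintro w ⟨-, h1, hy, -⟩
    linarith
  have hF : IsSemialgebraicFunOn ℚ (Φ '' K.domain) (fun w => 1 / ((1 + w 0 ^ 2) * w 1)) := by
    have hq : ∀ w ∈ Φ '' K.domain, aeval w ((1 + X 0 ^ 2) * X 1 : MvPolynomial (Fin 2) ℚ) ≠ 0 := by
      intro w hw
      have h : (0 : ℝ) < (1 + w 0 ^ 2) * w 1 := mul_pos (by positivity) (hpos w hw)
      simpa using h.ne'
    refine (isSemialgebraicFunOn_aeval_div_aeval hT 1 ((1 + X 0 ^ 2) * X 1) hq).congr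
      fun w _ => ?_
    simp
  have hI : IntegrableOn (fun w : Fin 2 → ℝ => 1 / ((1 + w 0 ^ 2) * w 1)) (Φ '' K.domain) := by
    rw [integrableOn_image_iff_integrableOn_abs_det_fderiv_smul volume hmeas hderiv hinj]
    refine K.integrableOn.congr_fun (fun x hx => ?_) hmeas
    rw [hjac x hx, smul_eq_mul, mul_comm]
  refine ⟨⟨⟨Φ '' K.domain, _, hT, hF, hI⟩, himage, fun _ _ => rfl⟩, ?_⟩
  -- EVERY `[band, g]` is one change-of-variables move away from `K`
  intro B hB hBi
  refine KZ.changeOfVariablesRel_subset_relations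
    ⟨2, K, B, Φ, Φ', hΦsa, hderiv, hinj, hB.trans himage.symm, fun x hx => ?_, rfl⟩
  have hx' : Φ x ∈ B.domain := by
    rw [hB, ← himage]
    exact mem_image_of_mem Φ hx
  rw [hjac x hx, hBi hx']

end Summit.KontsevichZagierPeriods.HyperbolicBloch.OffTetraSectorKernel

end
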